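import Summits.QuantumFields.GaugeBoot.Rows.KZL2rpD3STab
import HarnessLib

/-!
# Gauge-boot: kernel check of the raw `site1` class table of the kz-L2-rp-3D problems, rows 0–30 (part 1/6)

Cell `pub-gaugeboot` (HOME `run/shared/lean/pub/pub-gaugeboot/`), seat lean1 (torus positivity layer for rows C15–C19, C34–C40 (+ the w1x2 / w1x3 / w2x2 windows of the same family) =
the certified kz-L2-rp-3D windows: label set, reflection lines, class/witness tables, the reduction identity; Hermitian half transported from `KZL2HD3`).

HONEST FRAMING (page 1 of every file of this cell): certified bounds on lattice expectations at STATED coupling,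
gauge group, dimension and torus size; NOT a mass gap, NOT a continuum limit, NOT a string tension, NOT large `N`.
The venture is explicitly NOT Yang–Mills-summit-bearing (barriers `FixedCouplingUltralocality`,
`PerturbativeInvisibility`).

`scanon_rows_<lo>_<hi> : ∀ i, lo ≤ i < hi → ∀ j ≥ i, KZL2rpD3.SCanonOK i j`, each range one closed computation (`decide +kernel`,
≤ 900 entries per theorem — farm calibration for D = 3 reflection words); assembled in `KZL2rpD3Red`.
-/

noncomputable section

open Literature.MathematicalPhysics.QuantumFieldTheory

namespace Summit.QuantumFields.GaugeBoot

namespace KZL2rpD3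

set_option maxHeartbeats 0 in
/-- Rows `0 ≤ i < 3` of the `site1` class table of the kz-L2-rp-3D problems canonicalise (900 entries; kernel). -/
theorem scanon_rows_0_3 : ∀ i : Fin 301, 0 ≤ i.val → i.val < 3 → ∀ j : Fin 301, i.val ≤ j.val → KZL2rpD3.SCanonOK i j := by
  decide +kernel

set_option maxHeartbeats 0 in
/-- Rows `3 ≤ i < 7` of the `site1` class table of the kz-L2-rp-3D problems canonicalise (1186 entries; kernel). -/
theorem scanon_rows_3_7 : ∀ i : Fin 301, 3 ≤ i.val → i.val < 7 → ∀ j : Fin 301, i.val ≤ j.val → KZL2rpD3.SCanonOK i j := by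
  decide +kernel

set_option maxHeartbeats 0 in
/-- Rows `7 ≤ i < 11` of the `site1` class table of the kz-L2-rp-3D problems canonicalise (1170 entries; kernel). -/
theorem scanon_rows_7_11 : ∀ i : Fin 301, 7 ≤ i.val → i.val < 11 → ∀ j : Fin 301, i.val ≤ j.val → KZL2rpD3.SCanonOK i j := by
  decide +kernel

set_option maxHeartbeats 0 in
/-- Rows `11 ≤ i < 15` of the `site1` class table of the kz-L2-rp-3D problems canonicalise (1154 entries; kernel). -/
theorem scanon_rows_11_15 : ∀ i : Fin 301, 11 ≤ i.val → i.val < 15 → ∀ j : Fin 301, i.val ≤ j.val → KZL2rpD3.SCanonOK i j := by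
  decide +kernel

set_option maxHeartbeats 0 in
/-- Rows `15 ≤ i < 19` of the `site1` class table of the kz-L2-rp-3D problems canonicalise (1138 entries; kernel). -/
theorem scanon_rows_15_19 : ∀ i : Fin 301, 15 ≤ i.val → i.val < 19 → ∀ j : Fin 301, i.val ≤ j.val → KZL2rpD3.SCanonOK i j := by
  decide +kernel

set_option maxHeartbeats 0 in
/-- Rows `19 ≤ i < 23` of the `site1` class table of the kz-L2-rp-3D problems canonicalise (1122 entries; kernel). -/
theorem scanon_rows_19_23 : ∀ i : Fin 301, 19 ≤ i.val → i.val < 23 → ∀ j : Fin 301, i.val ≤ j.val → KZL2rpD3.SCanonOK i j := by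
  decide +kernel

set_option maxHeartbeats 0 in
/-- Rows `23 ≤ i < 27` of the `site1` class table of the kz-L2-rp-3D problems canonicalise (1106 entries; kernel). -/
theorem scanon_rows_23_27 : ∀ i : Fin 301, 23 ≤ i.val → i.val < 27 → ∀ j : Fin 301, i.val ≤ j.val → KZL2rpD3.SCanonOK i j := by
  decide +kernel

set_option maxHeartbeats 0 in
/-- Rows `27 ≤ i < 31` of the `site1` class table of the kz-L2-rp-3D problems canonicalise (1090 entries; kernel). -/
theorem scanon_rows_27_31 : ∀ i : Fin 301, 27 ≤ i.val → i.val < 31 → ∀ j : Fin 301, i.val ≤ j.val → KZL2rpD3.SCanonOK i j := by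
  decide +kernel

end KZL2rpD3

end Summit.QuantumFields.GaugeBoot

end
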